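import Summits.CriticalPhenomena.CardyFormulaZ2.Theorems.CardyIKTransportIKMixedBoxCrossingTransportLinkDefs
import Summits.CriticalPhenomena.CardyFormulaZ2.Theorems.CardyIKTransportIKMixedBoxCrossingTransportStubSlabDeterminacy

/-!
# Stub `stub_necklaceConst` (line `defect-closure-exploration`, reshape v5b, crux `IKMixedBoxCrossing`,
# stmt-CriticalPhenomena-5911)

Support file (`--supports stmt-CriticalPhenomena-5911`): `NecklaceExists ∧ LinkConst` of `…TransportLinkDefs` §4.

* (A) `NecklaceExists`.  Pick a base row `b` with `ξ b = true`, `ξ (b - 1) = false` (`exists_base`: otherwise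
  blackness propagates downwards around the cycle); read the column linearly, `η o = ξ (b + o)` (`o < L`), so
  `η 0 = true`, `η (L - 1) = false`; decompose `η` on `[0, L)` into blocks "black run, then white gap" by strong
  induction on the length, splitting off the LAST block (`lin_dec`: `Nat.findGreatest` locates the last black offset
  and the last white offset before it; `dec_one`, `dec_snoc`); the prefix sums `∑ j ∈ range i, (rl j + gl j)` of the
  block lengths are the `runStart`s (`sum_filter_lt`) and offsets `< L` correspond to rows through `ZMod.val`
  (`col_mk`).
* (B) `LinkConst`.  Black connectivity is monochromatic reachability (`SlabDetStub.blackConn_iff`); follow a black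
  walk of the gluing `(splitEquiv w L).symm (y, p)` from column `0`: off the new cell column `w + 1` its edges read
  only data shared with the gluing of `q` (`adj_transfer`, from `SlabDetStub.adj_congr`); it enters or leaves column
  `w + 1` only through a BLACK cell of the constant column `w` (`SlabDetStub.adj_col`), which is then all black, so
  any two of its cells are joined by vertical edges (`reach_lastCol`): every excursion into column `w + 1` is replaced
  by a detour inside column `w` (`reach_transfer`).
-/

noncomputable section

namespace Summit.CriticalPhenomena.CardyFormulaZ2.Cruxes.IKMixedBoxCrossing.DefectClosureExploration

open scoped BigOperators Classical
open Finset
open CylBunchStub (splitEquiv)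
open Summit.CriticalPhenomena.CardyFormulaZ2.Theorems.IKLinearTransport.PinnedDiagramExchange
  (monoGraph monoGraph_adj)
open SlabDetStub (adj_col adj_congr blackConn_iff)

namespace NecklaceConstStub

/-! ## (A) Linear run/gap decompositions and the necklace of a cyclic column

A decomposition of `[0, n)` into `k` blocks is a pair of sequences `rl`, `gl` (run and gap lengths, all `≥ 1` below
`k`) whose prefix sums `∑ j ∈ range i, (rl j + gl j)` are the block starts, the `k`-th being `n`. -/

/-- A single block decomposing `[0, n)`: black on `[0, p]`, white on `(p, n)`. -/
theorem dec_one (η : ℕ → Bool) {n p : ℕ} {rl gl : ℕ → ℕ} (hp : p < n - 1) (htrue : ∀ o ≤ p, η o = true)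
    (hfalse : ∀ o, p < o → o < n → η o = false) (hr0 : rl 0 = p + 1) (hg0 : gl 0 = n - 1 - p) :
    (∀ i < 1, 1 ≤ rl i) ∧ (∀ i < 1, 1 ≤ gl i) ∧ ∑ j ∈ range 1, (rl j + gl j) = n ∧ ∀ o < n, (η o = true ↔
      ∃ i < 1, ∑ j ∈ range i, (rl j + gl j) ≤ o ∧ o < ∑ j ∈ range i, (rl j + gl j) + rl i) := by
  refine ⟨fun i hi => by rw [Nat.lt_one_iff.1 hi]; omega, fun i hi => by rw [Nat.lt_one_iff.1 hi]; omega,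
    by rw [Finset.sum_range_one]; omega, fun o ho => ⟨fun h => ?_, ?_⟩⟩
  · refine ⟨0, Nat.one_pos, by rw [Finset.sum_range_zero]; exact Nat.zero_le _, ?_⟩
    rw [Finset.sum_range_zero, zero_add, hr0]
    by_contra hc
    rw [hfalse o (by omega) ho] at h
    exact Bool.false_ne_true h
  · rintro ⟨i, hi, -, h2⟩
    obtain rfl : i = 0 := by omega
    rw [Finset.sum_range_zero, zero_add] at h2
    exact htrue o (by omega)

/-- Adding a last block to a decomposition of `[0, q + 1)`: black on `(q, p]`, white on `(p, n)`. -/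
theorem dec_snoc (η : ℕ → Bool) {n k p q : ℕ} {rl gl rl' gl' : ℕ → ℕ}
    (hd : (∀ i < k, 1 ≤ rl i) ∧ (∀ i < k, 1 ≤ gl i) ∧ ∑ j ∈ range k, (rl j + gl j) = q + 1 ∧ ∀ o < q + 1,
      (η o = true ↔ ∃ i < k, ∑ j ∈ range i, (rl j + gl j) ≤ o ∧ o < ∑ j ∈ range i, (rl j + gl j) + rl i))
    (hqp : q < p) (hpn : p < n - 1) (htrue : ∀ o, q < o → o ≤ p → η o = true)
    (hfalse : ∀ o, p < o → o < n → η o = false)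
    (hrk : ∀ i < k, rl' i = rl i) (hgk : ∀ i < k, gl' i = gl i) (hrK : rl' k = p - q) (hgK : gl' k = n - 1 - p) :
    (∀ i < k + 1, 1 ≤ rl' i) ∧ (∀ i < k + 1, 1 ≤ gl' i) ∧ ∑ j ∈ range (k + 1), (rl' j + gl' j) = n ∧ ∀ o < n,
      (η o = true ↔
        ∃ i < k + 1, ∑ j ∈ range i, (rl' j + gl' j) ≤ o ∧ o < ∑ j ∈ range i, (rl' j + gl' j) + rl' i) := by
  obtain ⟨hr, hg, hsum, hchar⟩ := hd
  have hPS : ∀ i ≤ k, ∑ j ∈ range i, (rl' j + gl' j) = ∑ j ∈ range i, (rl j + gl j) := fun i hi =>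
    Finset.sum_congr rfl fun j hj => by
      have hjk : j < k := lt_of_lt_of_le (Finset.mem_range.1 hj) hi
      rw [hrk j hjk, hgk j hjk]
  refine ⟨fun i hi => ?_, fun i hi => ?_, ?_, fun o ho => ?_⟩
  · rcases Nat.lt_succ_iff_lt_or_eq.1 hi with h | rfl
    · exact hrk i h ▸ hr i h
    · omega
  · rcases Nat.lt_succ_iff_lt_or_eq.1 hi with h | rfl
    · exact hgk i h ▸ hg i h
    · omega
  · rw [Finset.sum_range_succ, hPS k le_rfl, hsum, hrK, hgK]
    omega
  · by_cases hoq : o < q + 1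
    · rw [hchar o hoq]
      constructor
      · rintro ⟨i, hi, h1, h2⟩
        exact ⟨i, Nat.lt_succ_of_lt hi, by rw [hPS i hi.le]; exact h1, by rw [hPS i hi.le, hrk i hi]; exact h2⟩
      · rintro ⟨i, hi, h1, h2⟩
        rcases Nat.lt_succ_iff_lt_or_eq.1 hi with h | rfl
        · exact ⟨i, h, by rw [← hPS i h.le]; exact h1, by rw [← hPS i h.le, ← hrk i h]; exact h2⟩
        · rw [hPS i le_rfl, hsum] at h1
          omega
    · push Not at hoq
      constructor
      · intro h
        have hop : o ≤ p := by
          by_contra hc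
          rw [hfalse o (by omega) ho] at h
          exact Bool.false_ne_true h
        refine ⟨k, Nat.lt_succ_self k, by rw [hPS k le_rfl, hsum]; exact hoq, ?_⟩
        rw [hPS k le_rfl, hsum, hrK]
        omega
      · rintro ⟨i, hi, -, h2⟩
        rcases Nat.lt_succ_iff_lt_or_eq.1 hi with h | rfl
        · rw [hPS i h.le, hrk i h] at h2
          have hmono : ∑ j ∈ range (i + 1), (rl j + gl j) ≤ ∑ j ∈ range k, (rl j + gl j) :=
            Finset.sum_le_sum_of_subset (Finset.range_mono (Nat.succ_le_of_lt h))
          rw [Finset.sum_range_succ, hsum] at hmono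
          omega
        · rw [hPS i le_rfl, hsum, hrK] at h2
          exact htrue o (by omega) (by omega)

/-- LINEAR DECOMPOSITION: a Boolean sequence black at `0` and white at `n - 1` decomposes on `[0, n)` into blocks
"black run, then white gap" (strong induction on `n`, splitting off the last block). -/
theorem lin_dec (n : ℕ) : ∀ η : ℕ → Bool, η 0 = true → 0 < n → η (n - 1) = false →
    ∃ (k : ℕ) (rl gl : ℕ → ℕ), (∀ i < k, 1 ≤ rl i) ∧ (∀ i < k, 1 ≤ gl i) ∧ ∑ j ∈ range k, (rl j + gl j) = n ∧
      ∀ o < n, (η o = true ↔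
        ∃ i < k, ∑ j ∈ range i, (rl j + gl j) ≤ o ∧ o < ∑ j ∈ range i, (rl j + gl j) + rl i) := by
  induction n using Nat.strong_induction_on with
  | _ n ih =>
  intro η h0 hn hlast
  -- the last black offset `p`
  obtain ⟨p, hp⟩ : ∃ p, Nat.findGreatest (fun o => η o = true) (n - 1) = p := ⟨_, rfl⟩
  obtain ⟨hple, hp0, hpmax⟩ := Nat.findGreatest_eq_iff.1 hp
  have hp1 : η p = true := by
    rcases Nat.eq_zero_or_pos p with rfl | h
    · exact h0
    · exact hp0 h.ne'
  have hplt : p < n - 1 := lt_of_le_of_ne hple fun h => by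
    rw [h, hlast] at hp1
    exact Bool.false_ne_true hp1
  have hfalse : ∀ o, p < o → o < n → η o = false := fun o h1 h2 =>
    eq_false_of_ne_true (hpmax h1 (by omega))
  by_cases hq : ∃ o ≤ p, η o = false
  · -- the last white offset `q ≤ p`: the blocks of `[0, q]` (induction) and the new block `(q, p] ∪ (p, n)`
    obtain ⟨o₀, ho₀, hη₀⟩ := hq
    obtain ⟨q, hq⟩ : ∃ q, Nat.findGreatest (fun o => η o = false) p = q := ⟨_, rfl⟩
    have hq1 : η q = false := by
      rw [← hq]
      exact Nat.findGreatest_spec (P := fun o => η o = false) ho₀ hη₀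
    obtain ⟨hqle, -, hqmax⟩ := Nat.findGreatest_eq_iff.1 hq
    have hqlt : q < p := lt_of_le_of_ne hqle fun h => by
      rw [h, hp1] at hq1
      exact Bool.noConfusion hq1
    have htrue : ∀ o, q < o → o ≤ p → η o = true := fun o h1 h2 => eq_true_of_ne_false (hqmax h1 h2)
    obtain ⟨k, rl, gl, hd⟩ := ih (q + 1) (by omega) η h0 (Nat.succ_pos q) (by simpa using hq1)
    exact ⟨k + 1, fun i => if i < k then rl i else p - q, fun i => if i < k then gl i else n - 1 - p,
      dec_snoc η hd hqlt hplt htrue hfalse (fun i hi => if_pos hi) (fun i hi => if_pos hi)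
        (if_neg (lt_irrefl k)) (if_neg (lt_irrefl k))⟩
  · push Not at hq
    exact ⟨1, fun _ => p + 1, fun _ => n - 1 - p,
      dec_one η hplt (fun o ho => eq_true_of_ne_false (hq o ho)) hfalse rfl rfl⟩

/-- A filtered sum over `Fin k` of the indices below `i` is the prefix sum of length `i`. -/
theorem sum_filter_lt {k : ℕ} (g : Fin k → ℕ) (rl gl : ℕ → ℕ) (hfg : ∀ j, g j = rl j + gl j) (i : Fin k) :
    ∑ j ∈ Finset.univ.filter (fun j : Fin k => j < i), g j = ∑ j ∈ range i, (rl j + gl j) := by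
  rw [Finset.sum_filter]
  have h1 : ∀ j : Fin k, (if j < i then g j else 0) =
      (fun m : ℕ => if m < (i : ℕ) then rl m + gl m else 0) (j : ℕ) := fun j => by
    simp only [Fin.lt_def, hfg]
  rw [Finset.sum_congr rfl fun j _ => h1 j,
    Fin.sum_univ_eq_sum_range (fun m : ℕ => if m < (i : ℕ) then rl m + gl m else 0) k, ← Finset.sum_filter]
  congr 1
  ext m
  simp only [Finset.mem_filter, Finset.mem_range]
  have := i.isLt
  omega

/-- A BASE ROW: a cyclic column taking both values has a black row just above a white row. -/
theorem exists_base {L : ℕ} (ξ : ZMod L → Bool) (ht : ∃ r, ξ r = true) (hf : ∃ r, ξ r = false) [NeZero L] :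
    ∃ b : ZMod L, ξ b = true ∧ ξ (b - 1) = false := by
  by_contra h
  have h' : ∀ b, ξ b = true → ξ (b - 1) = true := fun b hb => by
    by_contra hc
    exact h ⟨b, hb, eq_false_of_ne_true hc⟩
  obtain ⟨r₀, hr₀⟩ := ht
  obtain ⟨r₁, hr₁⟩ := hf
  have key : ∀ m : ℕ, ξ (r₀ - m) = true := by
    intro m
    induction m with
    | zero => simpa using hr₀
    | succ m ih =>
      rw [Nat.cast_succ, ← sub_sub]
      exact h' _ ih
  have h1 := key (r₀ - r₁).val
  rw [ZMod.natCast_zmod_val, sub_sub_cancel, hr₁] at h1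
  exact Bool.noConfusion h1

/-- THE COLUMN OF THE CONSTRUCTED NECKLACE: if `(rl, gl)` decomposes the linear reading `o ↦ ξ (b + o)` of `ξ` on
`[0, L)`, the necklace with these blocks and base `b` presents `ξ`. -/
theorem col_mk {L : ℕ} [NeZero L] (ξ : ZMod L → Bool) (b : ZMod L) {k : ℕ} (hk : 0 < k) (rl gl : ℕ → ℕ)
    (hd : (∀ i < k, 1 ≤ rl i) ∧ (∀ i < k, 1 ≤ gl i) ∧ ∑ j ∈ range k, (rl j + gl j) = L ∧
      ∀ o < L, (ξ (b + (o : ZMod L)) = true ↔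
        ∃ i < k, ∑ j ∈ range i, (rl j + gl j) ≤ o ∧ o < ∑ j ∈ range i, (rl j + gl j) + rl i)) :
    (Necklace.mk k hk (fun i => rl i) (fun i => gl i) (fun i => hd.1 i i.isLt) (fun i => hd.2.1 i i.isLt) b
      ((Fin.sum_univ_eq_sum_range (fun j => rl j + gl j) k).trans hd.2.2.1)).col = ξ := by
  set N : Necklace L := Necklace.mk k hk (fun i => rl i) (fun i => gl i) (fun i => hd.1 i i.isLt)
    (fun i => hd.2.1 i i.isLt) b ((Fin.sum_univ_eq_sum_range (fun j => rl j + gl j) k).trans hd.2.2.1) with hN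
  have hrs : ∀ i : Fin k, N.runStart i = ∑ j ∈ range i, (rl j + gl j) := fun i =>
    sum_filter_lt (fun j : Fin k => rl j + gl j) rl gl (fun _ => rfl) i
  funext r
  have hvL : (r - b).val < L := ZMod.val_lt _
  have hrow : b + (((r - b).val : ℕ) : ZMod L) = r := by rw [ZMod.natCast_zmod_val, add_sub_cancel]
  have huniq : ∀ o, o < L → b + (o : ZMod L) = r → o = (r - b).val := fun o ho h => by
    rw [← h, add_sub_cancel_left, ZMod.val_natCast_of_lt ho]
  have hiff : (∃ i : Fin N.k, ∃ o : ℕ, o < L ∧ N.InRun i o ∧ N.row o = r) ↔ ξ r = true := by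
    rw [← hrow, hd.2.2.2 _ hvL, hrow]
    constructor
    · rintro ⟨i, o, ho, hin, hro⟩
      obtain rfl := huniq o ho hro
      refine ⟨i, i.isLt, ?_⟩
      simpa only [Necklace.InRun, Necklace.gapStart, hrs] using hin
    · rintro ⟨i, hi, hin⟩
      refine ⟨⟨i, hi⟩, _, hvL, ?_, hrow⟩
      simpa only [Necklace.InRun, Necklace.gapStart, hrs] using hin
  rw [Bool.eq_iff_iff, ← hiff]
  exact decide_eq_true_iff

/-- (A) `NecklaceExists`. -/
theorem necklaceExists : NecklaceExists := by
  intro L _ ξ ht hf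
  obtain ⟨b, hb1, hb0⟩ := exists_base ξ ht hf
  have hL : 0 < L := Nat.pos_of_ne_zero (NeZero.ne L)
  have h0 : (fun o : ℕ => ξ (b + (o : ZMod L))) 0 = true := by simpa using hb1
  have hlast : (fun o : ℕ => ξ (b + (o : ZMod L))) (L - 1) = false := by
    simp only [Nat.cast_pred hL, ZMod.natCast_self, zero_sub, ← sub_eq_add_neg]
    exact hb0
  obtain ⟨k, rl, gl, hd⟩ := lin_dec L (fun o : ℕ => ξ (b + (o : ZMod L))) h0 hL hlast
  have hk : 0 < k := Nat.pos_of_ne_zero fun h => by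
    have h' := hd.2.2.1
    rw [h, Finset.sum_range_zero] at h'
    exact (NeZero.ne L) h'.symm
  exact ⟨_, col_mk ξ b hk rl gl hd⟩

/-! ## (B) A constant last interior column makes the arcs event independent of the new column -/

variable {w L : ℕ}

/-- Colours of the glued configuration off the new column. -/
theorem glue_fst_castSucc (y : CylCfg w L) (p : (ZMod L → Bool) × (ZMod L → Bool)) (i : Fin (w + 1))
    (r : ZMod L) : ((splitEquiv w L).symm (y, p)).1 (i.castSucc, r) = y.1 (i, r) := by
  simp [splitEquiv]

/-- Two gluings agree on the colours off the new cell column `w + 1`. -/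
theorem glue_fst_eq (y : CylCfg w L) (p q : (ZMod L → Bool) × (ZMod L → Bool)) (c : Fin (w + 1 + 1) × ZMod L)
    (hc : c.1.val ≠ w + 1) : ((splitEquiv w L).symm (y, p)).1 c = ((splitEquiv w L).symm (y, q)).1 c := by
  obtain ⟨c1, r⟩ := c
  induction c1 using Fin.lastCases with
  | last => exact absurd (Fin.val_last _) hc
  | cast i => rw [glue_fst_castSucc, glue_fst_castSucc]

/-- Two gluings agree on the flags off the new face column `w`. -/
theorem glue_snd_eq (y : CylCfg w L) (p q : (ZMod L → Bool) × (ZMod L → Bool)) (f : Fin (w + 1) × ZMod L)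
    (hf : f.1.val ≠ w) : ((splitEquiv w L).symm (y, p)).2 f = ((splitEquiv w L).symm (y, q)).2 f := by
  obtain ⟨f1, r⟩ := f
  induction f1 using Fin.lastCases with
  | last => exact absurd (Fin.val_last _) hf
  | cast j => simp [splitEquiv]

/-- Off the new cell column `w + 1`, two configurations with the same colours off that column and the same flags off
the new face column `w` have the same monochromatic edges. -/
theorem adj_transfer {x x' : CylCfg (w + 1) L}
    (hcol : ∀ c : Fin (w + 1 + 1) × ZMod L, c.1.val ≠ w + 1 → x.1 c = x'.1 c)
    (hflg : ∀ f : Fin (w + 1) × ZMod L, f.1.val ≠ w → f.1.val ≠ w + 1 → x.2 f = x'.2 f)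
    {u v : Fin (w + 1 + 1) × ZMod L} (hu : u.1.val ≠ w + 1) (hv : v.1.val ≠ w + 1)
    (h : (cylGraph (w + 1) L x.2 ⊓ monoGraph x.1).Adj u v) : (cylGraph (w + 1) L x'.2 ⊓ monoGraph x'.1).Adj u v := by
  rw [SimpleGraph.inf_adj, monoGraph_adj] at h ⊢
  obtain ⟨hadj, hne, hc⟩ := h
  refine ⟨(adj_congr hflg hu hv).1 hadj, hne, ?_⟩
  rw [← hcol u hu, ← hcol v hv]
  exact hc

/-- A cell of cell column `w` (the last interior column). -/
theorem eq_lastCol {z : Fin (w + 1 + 1) × ZMod L} (hz : z.1.val = w) : z = ((Fin.last w).castSucc, z.2) :=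
  Prod.ext (Fin.ext (by simp [hz])) rfl

/-- Inside an all-black column `w`, the cell at row `s` is joined to the cell at row `s + m`. -/
theorem reach_lastCol (x : CylCfg (w + 1) L) (hb : ∀ r, x.1 ((Fin.last w).castSucc, r) = true) (s : ZMod L)
    (m : ℕ) : (cylGraph (w + 1) L x.2 ⊓ monoGraph x.1).Reachable ((Fin.last w).castSucc, s)
      ((Fin.last w).castSucc, s + (m : ZMod L)) := by
  induction m with
  | zero => simp
  | succ m ih =>
    refine ih.trans ?_
    rw [Nat.cast_succ, ← add_assoc]
    by_cases heq : (((Fin.last w).castSucc, s + (m : ZMod L)) : Fin (w + 1 + 1) × ZMod L) =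
        ((Fin.last w).castSucc, s + (m : ZMod L) + 1)
    · rw [← heq]
    · refine SimpleGraph.Adj.reachable ?_
      rw [SimpleGraph.inf_adj, monoGraph_adj]
      refine ⟨?_, heq, by rw [hb, hb]⟩
      rw [cylGraph, SimpleGraph.fromRel_adj]
      exact ⟨heq, Or.inl (Or.inl ⟨rfl, rfl⟩)⟩

/-- Inside an all-black column `w`, any two cells are joined. -/
theorem reach_lastCol' [NeZero L] (x : CylCfg (w + 1) L) (hb : ∀ r, x.1 ((Fin.last w).castSucc, r) = true)
    (s s' : ZMod L) : (cylGraph (w + 1) L x.2 ⊓ monoGraph x.1).Reachable ((Fin.last w).castSucc, s)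
      ((Fin.last w).castSucc, s') := by
  have h := reach_lastCol x hb s (s' - s).val
  rwa [ZMod.natCast_zmod_val, add_sub_cancel] at h

/-- PATH TRANSFER: two configurations with the same colours off the new cell column `w + 1`, the same flags off the
new face column `w` and a constant column `w`; then a monochromatic walk of the first from a black cell off column
`w + 1` to a cell off column `w + 1` yields one of the second (off column `w + 1` the edges are shared; the walk
enters and leaves column `w + 1` through black cells of column `w`, which is then all black, and the excursion is
replaced by a detour inside column `w`). -/
theorem reach_transfer [NeZero L] {x x' : CylCfg (w + 1) L} (b : Bool) (hb : ∀ r, x.1 ((Fin.last w).castSucc, r) = b)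
    (hcol : ∀ c : Fin (w + 1 + 1) × ZMod L, c.1.val ≠ w + 1 → x.1 c = x'.1 c)
    (hflg : ∀ f : Fin (w + 1) × ZMod L, f.1.val ≠ w → f.1.val ≠ w + 1 → x.2 f = x'.2 f)
    {u v : Fin (w + 1 + 1) × ZMod L} (hu : u.1.val ≠ w + 1) (hbl : x.1 u = true)
    (h : (cylGraph (w + 1) L x.2 ⊓ monoGraph x.1).Reachable u v) (hv : v.1.val ≠ w + 1) :
    (cylGraph (w + 1) L x'.2 ⊓ monoGraph x'.1).Reachable u v := by
  have hcw : ∀ r : ZMod L, (((Fin.last w).castSucc, r) : Fin (w + 1 + 1) × ZMod L).1.val ≠ w + 1 := fun r => by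
    simp only [Fin.val_castSucc, Fin.val_last]
    omega
  rw [SimpleGraph.reachable_iff_reflTransGen] at h
  suffices key : x.1 v = true ∧ (v.1.val ≠ w + 1 → (cylGraph (w + 1) L x'.2 ⊓ monoGraph x'.1).Reachable u v) ∧
      (v.1.val = w + 1 →
        ∃ s : ZMod L, (cylGraph (w + 1) L x'.2 ⊓ monoGraph x'.1).Reachable u ((Fin.last w).castSucc, s)) from
    key.2.1 hv
  clear hv
  induction h with
  | refl => exact ⟨hbl, fun _ => SimpleGraph.Reachable.refl _, fun h => absurd h hu⟩
  | @tail z z' _ hzz' ih =>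
    obtain ⟨hzb, ih1, ih2⟩ := ih
    have hadj := hzz'
    rw [SimpleGraph.inf_adj, monoGraph_adj] at hzz'
    obtain ⟨hcyl, -, hc⟩ := hzz'
    have hz'b : x.1 z' = true := hc ▸ hzb
    have hcols := adj_col hcyl
    refine ⟨hz'b, fun hz' => ?_, fun hz' => ?_⟩
    · by_cases hz : z.1.val = w + 1
      · -- back from the new column: `z'` lies in column `w`, which is therefore black
        have hz'w : z'.1.val = w := by omega
        rw [eq_lastCol hz'w, hb] at hz'b
        obtain ⟨s, hs⟩ := ih2 hz
        rw [eq_lastCol hz'w]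
        exact hs.trans (reach_lastCol' x' (fun r => by rw [← hcol _ (hcw r), hb, hz'b]) s z'.2)
      · exact (ih1 hz).trans (adj_transfer hcol hflg hz hz' hadj).reachable
    · by_cases hz : z.1.val = w + 1
      · exact ih2 hz
      · have hzw : z.1.val = w := by omega
        refine ⟨z.2, ?_⟩
        rw [← eq_lastCol hzw]
        exact ih1 hz

/-- (B) `LinkConst`. -/
theorem linkConst : LinkConst := by
  intro w L n _ y b hb
  suffices key : ∀ p q : (ZMod L → Bool) × (ZMod L → Bool),
      (splitEquiv w L).symm (y, p) ∈ arcsEvent (w + 1) L n → (splitEquiv w L).symm (y, q) ∈ arcsEvent (w + 1) L n from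
    fun p q => ⟨key p q, key q p⟩
  intro p q hp
  simp only [arcsEvent, Set.mem_setOf_eq] at hp ⊢
  obtain ⟨r₁, r₂, h1, h2, h3, h4, hB⟩ := hp
  refine ⟨r₁, r₂, h1, h2, h3, h4, ?_⟩
  have h0 : ∀ r : ZMod L, (((0 : Fin (w + 1 + 1)), r) : Fin (w + 1 + 1) × ZMod L).1.val ≠ w + 1 := fun r => by
    simp only [Fin.val_zero]
    omega
  have hbx : ∀ r, ((splitEquiv w L).symm (y, p)).1 ((Fin.last w).castSucc, r) = b := fun r => by
    rw [glue_fst_castSucc, hb]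
  rw [blackConn_iff] at hB ⊢
  obtain ⟨hbl, hreach⟩ := hB
  exact ⟨by rw [← glue_fst_eq y p q _ (h0 r₁)]; exact hbl, reach_transfer b hbx (glue_fst_eq y p q)
    (fun f hf _ => glue_snd_eq y p q f hf) (h0 r₁) hbl hreach (h0 r₂)⟩

end NecklaceConstStub

open NecklaceConstStub in
/-- **STUB · `stub_necklaceConst`**: `NecklaceExists ∧ LinkConst` — every cyclic Boolean column taking both values
is presented by a necklace (linear run/gap decomposition from a base row), and a constant last interior column makes
the arcs event of the glued slab independent of the new column (path transfer off the new column, detours inside the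
constant column when it is black). -/
theorem stub_necklaceConst : NecklaceExists ∧ LinkConst :=
  ⟨necklaceExists, linkConst⟩

end Summit.CriticalPhenomena.CardyFormulaZ2.Cruxes.IKMixedBoxCrossing.DefectClosureExploration

end
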